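import Summits.NavierStokesRegularity.NavierStokesRegularity.Theorems.HardyPointSinkHardyEnergyBoundLocalHardyIdentityLimits
import HarnessLib

/-!
# Route HardyPointSink — `HardyEnergyBound`: the localised Hardy flux at a fixed time slice

Helper file for the crux item stmt-NavierStokesRegularity-7979 (`HardyEnergyBound`), stub
`stub_localHardyIdentity` of the line `birth` (the local energy identity of a classical
Navier–Stokes solution tested against `φ(x)/|x - x₀|`, `φ ∈ C_c^∞(ℝ³)`). With the regularised
weights `ψₙ(x) = regKernel aₙ (x - x₀) φ(x)`, `aₙ = (n+1)⁻²`, inserted in the local energy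
identity, this file computes the `n → ∞` limits at a fixed time slice `(v, q) = (u(s), p(s))`:

* the Hardy energy `∫ ψₙ |v|² → ∫ φ|v|²/|x - x₀|`;
* the flux `∫ (νΔψₙ|v|² + Dψₙ(v)|v|² + 2qDψₙ(v)) − 2ν∫|∇v|²ψₙ →
  ∫ (ν|v|²(Δφ/r − 2Dφ(x−x₀)/r³) + (|v|² + 2q)Dφ(v)/r − 2φ(|v|²/2 + q)⟨v, x−x₀⟩/r³)
  − 4πν φ(x₀)|v(x₀)|² − 2ν ∫ φ|∇v|²/r` (the point sink comes from `Δ regKernel a = -regBump a`,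
  an approximate identity of mass `4π`), together with a bound depending only on
  `ν`, on a common bound `C` for `|φ|, ‖Dφ‖, |Δφ|` and for `‖v‖, ‖∇v‖, |q|` on `tsupport φ`, on
  the radius `R` of a ball about `0` containing `tsupport φ`, and on `x₀` — uniform in the slice,
  as needed for dominated convergence in time.

## References

* L. Caffarelli, R. Kohn, L. Nirenberg, CPAM 35 (1982), §2; D. Gilbarg, N. Trudinger, (2.12);
  G. Seregin, *Lecture notes on regularity theory for the Navier–Stokes equations* (2014),
  p. 113.
-/

noncomputable section

open MeasureTheory Metric Set Filter Topology TopologicalSpace Function InnerProductSpace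
open Literature.Analysis.PDE Literature.Analysis.FluidPDE
open scoped RealInnerProductSpace Laplacian NNReal Interval ContDiff

set_option linter.dupNamespace false -- nested layout Summit.<S>.<Sub>, Sub = S (D-0017)

namespace Summit.NavierStokesRegularity.NavierStokesRegularity.Theorems

/-! ### The limits at a fixed time slice -/

/-- **The Hardy energy at a fixed time**: `∫ regKernel aₙ (x - x₀) φ |v|² → ∫ φ|v|²/|x - x₀|`
for `φ` continuous, supported in `B̄(0, R)`, `|φ| ≤ C`, and `v` continuous with `‖v‖ ≤ C` on
`tsupport φ`. -/
theorem hardyEnergyBound_localHardyIdentity_slice_energy (x₀ : EuclideanSpace ℝ (Fin 3))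
    {C R : ℝ} (hC : 0 ≤ C) (hR : 0 ≤ R) {φ : EuclideanSpace ℝ (Fin 3) → ℝ} (hφc : Continuous φ)
    (hφR : tsupport φ ⊆ closedBall (0 : EuclideanSpace ℝ (Fin 3)) R) (hφC : ∀ x, |φ x| ≤ C)
    {v : EuclideanSpace ℝ (Fin 3) → EuclideanSpace ℝ (Fin 3)} (hv : Continuous v)
    (hvC : ∀ x ∈ tsupport φ, ‖v x‖ ≤ C) :
    Tendsto (fun n : ℕ => ∫ x, Newtonian.regKernel ((((n : ℝ) + 1)⁻¹) ^ 2) (x - x₀) * φ x *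
      ‖v x‖ ^ 2) atTop (𝓝 (∫ x, φ x * ‖v x‖ ^ 2 / ‖x - x₀‖)) := by
  have hv2 : ∀ x ∈ tsupport φ, ‖v x‖ ^ 2 ≤ C ^ 2 := fun x hx =>
    pow_le_pow_left₀ (norm_nonneg _) (hvC x hx) 2
  have hgc : Continuous fun x => φ x * ‖v x‖ ^ 2 := hφc.mul ((hv.norm).pow 2)
  have hgB := hardyEnergyBound_localHardyIdentity_bound_G hR (by positivity : (0 : ℝ) ≤ C * C ^ 2)
    hφR (G := fun x => φ x * ‖v x‖ ^ 2)
    (fun x hx => by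
      rw [abs_mul, abs_of_nonneg (sq_nonneg ‖v x‖)]
      exact mul_le_mul (hφC x) (hv2 x hx) (sq_nonneg _) hC)
    (fun x hx => by rw [image_eq_zero_of_notMem_tsupport hx, zero_mul])
  have key := (hardyEnergyBound_localHardyIdentity_weight_term x₀ hgc hgB).1
  refine key.congr fun n => integral_congr_ae (Eventually.of_forall fun x => ?_)
  simp only
  ring

/-- **The Hardy energy limit, registered form**: for a continuous compactly supported `φ`, a
continuous field `v` and any centre `x₀`,
`∫ regKernel aₙ (x - x₀) φ(x) |v(x)|² dx → ∫ φ|v|²/|x - x₀|` along `aₙ = (n+1)⁻²` (the two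
boundary terms of the localised Hardy identity). -/
theorem hardyEnergyBound_localHardyIdentity_hardyEnergyLimit :
    ∀ (x₀ : EuclideanSpace ℝ (Fin 3)) (φ : EuclideanSpace ℝ (Fin 3) → ℝ), Continuous φ →
      HasCompactSupport φ → ∀ (v : EuclideanSpace ℝ (Fin 3) → EuclideanSpace ℝ (Fin 3)),
      Continuous v →
      Filter.Tendsto (fun n : ℕ => ∫ x,
        Literature.Analysis.PDE.Newtonian.regKernel ((((n : ℝ) + 1)⁻¹) ^ 2) (x - x₀) * φ x *
          ‖v x‖ ^ 2) Filter.atTop (nhds (∫ x, φ x * ‖v x‖ ^ 2 / ‖x - x₀‖)) := by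
  intro x₀ φ hφ hφc v hv
  obtain ⟨R, hR0, hR⟩ : ∃ R : ℝ, 0 < R ∧ tsupport φ ⊆ closedBall (0 : EuclideanSpace ℝ (Fin 3)) R :=
    hφc.isCompact.isBounded.subset_closedBall_lt 0 0
  obtain ⟨Cφ, hCφ⟩ := hφc.exists_bound_of_continuous hφ
  obtain ⟨Cv, hCv⟩ := hφc.isCompact.exists_bound_of_continuousOn hv.continuousOn
  have aφ := abs_nonneg Cφ
  have av := abs_nonneg Cv
  refine hardyEnergyBound_localHardyIdentity_slice_energy x₀ (C := |Cφ| + |Cv|) (by positivity)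
    hR0.le hφ hR (fun x => ?_) hv (fun x hx => ?_)
  · have h := hCφ x
    rw [Real.norm_eq_abs] at h
    linarith [le_abs_self Cφ]
  · linarith [hCv x hx, le_abs_self Cv]

/-- **The flux at a fixed time converges, with a uniform bound.** For `φ ∈ C²` supported in
`B̄(0, R)` with `|φ|, ‖Dφ‖, |Δφ| ≤ C`, a `C¹` field `v` and a continuous `q` with
`‖v‖, ‖Dv‖, |q| ≤ C` on `tsupport φ`, and the weights `ψₙ = regKernel aₙ (· - x₀) φ`: the flux
`∫ (νΔψₙ|v|² + Dψₙ(v)|v|² + 2qDψₙ(v)) - 2ν ∫ |∇v|² ψₙ` converges to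
`∫ (ν|v|²(Δφ/r − 2Dφ(x−x₀)/r³) + (|v|²+2q)Dφ(v)/r − 2φ(|v|²/2+q)⟨v,x−x₀⟩/r³) − 4πν φ(x₀)|v(x₀)|²
 − 2ν ∫ φ|∇v|²/r`, with a bound depending only on `ν, C, R, x₀`; and so does the dissipation
`∫ |∇v|² ψₙ → ∫ φ|∇v|²/r`. -/
theorem hardyEnergyBound_localHardyIdentity_slice_flux (x₀ : EuclideanSpace ℝ (Fin 3)) (ν : ℝ)
    {C R : ℝ} (hC : 0 ≤ C) (hR : 0 ≤ R) {φ : EuclideanSpace ℝ (Fin 3) → ℝ} (hφ : ContDiff ℝ 2 φ)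
    (hφs : HasCompactSupport φ) (hφR : tsupport φ ⊆ closedBall (0 : EuclideanSpace ℝ (Fin 3)) R)
    (hφC : ∀ x, |φ x| ≤ C) (hDφC : ∀ x, ‖fderiv ℝ φ x‖ ≤ C) (hΔφC : ∀ x, |(Δ φ) x| ≤ C)
    {v : EuclideanSpace ℝ (Fin 3) → EuclideanSpace ℝ (Fin 3)} (hv : ContDiff ℝ 1 v)
    {q : EuclideanSpace ℝ (Fin 3) → ℝ} (hq : Continuous q)
    (hvC : ∀ x ∈ tsupport φ, ‖v x‖ ≤ C) (hDvC : ∀ x ∈ tsupport φ, ‖fderiv ℝ v x‖ ≤ C)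
    (hqC : ∀ x ∈ tsupport φ, |q x| ≤ C) {ψ : ℕ → EuclideanSpace ℝ (Fin 3) → ℝ}
    (hψ : ∀ n : ℕ, ψ n = fun y =>
      Newtonian.regKernel ((((n : ℝ) + 1)⁻¹) ^ 2) (y - x₀) * φ y) :
    Tendsto (fun n : ℕ =>
        (∫ x, (ν * ((Δ (ψ n)) x * ‖v x‖ ^ 2) + fderiv ℝ (ψ n) x (v x) * ‖v x‖ ^ 2 +
          2 * (q x * fderiv ℝ (ψ n) x (v x)))) -
        2 * ν * ∫ x, frobeniusNormSq (fderiv ℝ v x) * ψ n x) atTop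
      (𝓝 ((∫ x, (ν * ‖v x‖ ^ 2 * ((Δ φ) x / ‖x - x₀‖ - 2 * fderiv ℝ φ x (x - x₀) / ‖x - x₀‖ ^ 3)
              + (‖v x‖ ^ 2 + 2 * q x) * fderiv ℝ φ x (v x) / ‖x - x₀‖
              - 2 * φ x * (‖v x‖ ^ 2 / 2 + q x) * ⟪v x, x - x₀⟫ / ‖x - x₀‖ ^ 3))
        - 4 * Real.pi * ν * φ x₀ * ‖v x₀‖ ^ 2
        - 2 * ν * ∫ x, φ x * frobeniusNormSq (fderiv ℝ v x) / ‖x - x₀‖)) ∧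
    (∀ n : ℕ, |(∫ x, (ν * ((Δ (ψ n)) x * ‖v x‖ ^ 2) + fderiv ℝ (ψ n) x (v x) * ‖v x‖ ^ 2 +
          2 * (q x * fderiv ℝ (ψ n) x (v x)))) -
        2 * ν * ∫ x, frobeniusNormSq (fderiv ℝ v x) * ψ n x| ≤
      |ν| * (C * C ^ 2 * (1 + R) ^ 4 *
          ∫ x : EuclideanSpace ℝ (Fin 3), ((1 + ‖x‖) ^ 4)⁻¹ * ‖x - x₀‖⁻¹) +
      2 * |ν| * (C * C ^ 2 * (1 + R) ^ 2 *
          ∫ x : EuclideanSpace ℝ (Fin 3), ((1 + ‖x‖) ^ 2)⁻¹ * (‖x - x₀‖ ^ 2)⁻¹) +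
      |ν| * (4 * Real.pi * (C * C ^ 2)) +
      C * C * (C ^ 2 + 2 * C) * (1 + R) ^ 4 *
          (∫ x : EuclideanSpace ℝ (Fin 3), ((1 + ‖x‖) ^ 4)⁻¹ * ‖x - x₀‖⁻¹) +
      C * C * (C ^ 2 + 2 * C) * (1 + R) ^ 2 *
          (∫ x : EuclideanSpace ℝ (Fin 3), ((1 + ‖x‖) ^ 2)⁻¹ * (‖x - x₀‖ ^ 2)⁻¹) +
      2 * |ν| * (C * (3 * C ^ 2) * (1 + R) ^ 4 *
          ∫ x : EuclideanSpace ℝ (Fin 3), ((1 + ‖x‖) ^ 4)⁻¹ * ‖x - x₀‖⁻¹)) ∧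
    Tendsto (fun n : ℕ => ∫ x, frobeniusNormSq (fderiv ℝ v x) * ψ n x) atTop
      (𝓝 (∫ x, φ x * frobeniusNormSq (fderiv ℝ v x) / ‖x - x₀‖)) ∧
    ∀ n : ℕ, |∫ x, frobeniusNormSq (fderiv ℝ v x) * ψ n x| ≤
      C * (3 * C ^ 2) * (1 + R) ^ 4 *
        ∫ x : EuclideanSpace ℝ (Fin 3), ((1 + ‖x‖) ^ 4)⁻¹ * ‖x - x₀‖⁻¹ := by
  -- the data
  have ha : ∀ n : ℕ, 0 < (((n : ℝ) + 1)⁻¹) ^ 2 := hardyPointSink_seq_pos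
  have hφ1 : ContDiff ℝ 1 φ := hφ.of_le one_le_two
  have hφcont : Continuous φ := hφ.continuous
  have hDφc : Continuous (fderiv ℝ φ) := hφ1.continuous_fderiv one_ne_zero
  have hΔφc : Continuous (Δ φ) := Literature.Analysis.FluidPDE.continuous_laplacian hφ
  have hvc : Continuous v := hv.continuous
  have hDvc : Continuous (fderiv ℝ v) := hv.continuous_fderiv one_ne_zero
  have h0φ : ∀ x, x ∉ tsupport φ → φ x = 0 := fun x hx => image_eq_zero_of_notMem_tsupport hx
  have h0D : ∀ x, x ∉ tsupport φ → fderiv ℝ φ x = 0 := fun x hx =>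
    fderiv_of_notMem_tsupport ℝ hx
  have h0Δ : ∀ x, x ∉ tsupport φ → (Δ φ) x = 0 := fun x hx =>
    Literature.Analysis.FluidPDE.laplacian_eq_zero_of_notMem_tsupport hx
  have hv2 : ∀ x ∈ tsupport φ, ‖v x‖ ^ 2 ≤ C ^ 2 := fun x hx =>
    pow_le_pow_left₀ (norm_nonneg _) (hvC x hx) 2
  have hhead : ∀ x ∈ tsupport φ, |‖v x‖ ^ 2 + 2 * q x| ≤ C ^ 2 + 2 * C := by
    intro x hx
    have h1 := hv2 x hx
    have h2 := hqC x hx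
    rw [abs_le] at h2 ⊢
    constructor <;> nlinarith [sq_nonneg ‖v x‖]
  have hDφv : ∀ x ∈ tsupport φ, |fderiv ℝ φ x (v x)| ≤ C * C := fun x hx => by
    rw [← Real.norm_eq_abs]
    exact (ContinuousLinearMap.le_opNorm _ _).trans
      (mul_le_mul (hDφC x) (hvC x hx) (norm_nonneg _) hC)
  have hDφξ : ∀ x, |fderiv ℝ φ x (x - x₀)| ≤ C * ‖x - x₀‖ := fun x => by
    rw [← Real.norm_eq_abs]
    exact (ContinuousLinearMap.le_opNorm _ _).trans
      (mul_le_mul_of_nonneg_right (hDφC x) (norm_nonneg _))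
  have hξv : ∀ x ∈ tsupport φ, |⟪x - x₀, v x⟫| ≤ ‖x - x₀‖ * C := fun x hx =>
    (abs_real_inner_le_norm _ _).trans (mul_le_mul_of_nonneg_left (hvC x hx) (norm_nonneg _))
  have hSc : Continuous fun x => ‖v x‖ ^ 2 + 2 * q x :=
    ((hvc.norm).pow 2).add (continuous_const.mul hq)
  -- (1) the Hardy-weight Laplacian term, `G₁ = Δφ |v|²`
  have hG₁c : Continuous fun x => (Δ φ) x * ‖v x‖ ^ 2 := hΔφc.mul ((hvc.norm).pow 2)
  have hG₁B := hardyEnergyBound_localHardyIdentity_bound_G hR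
    (by positivity : (0 : ℝ) ≤ C * C ^ 2) hφR (G := fun x => (Δ φ) x * ‖v x‖ ^ 2)
    (fun x hx => by
      rw [abs_mul, abs_of_nonneg (sq_nonneg ‖v x‖)]
      exact mul_le_mul (hΔφC x) (hv2 x hx) (sq_nonneg _) hC)
    (fun x hx => by rw [h0Δ x hx, zero_mul])
  obtain ⟨T1, B1, I1⟩ := hardyEnergyBound_localHardyIdentity_weight_term x₀ hG₁c hG₁B
  -- (2) the cross term, `W₂ = Dφ(x - x₀) |v|²`
  have hW₂c : Continuous fun x => fderiv ℝ φ x (x - x₀) * ‖v x‖ ^ 2 :=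
    (hDφc.clm_apply (continuous_id.sub continuous_const)).mul ((hvc.norm).pow 2)
  have hW₂B := hardyEnergyBound_localHardyIdentity_bound_W x₀ hR
    (by positivity : (0 : ℝ) ≤ C * C ^ 2) hφR (W := fun x => fderiv ℝ φ x (x - x₀) * ‖v x‖ ^ 2)
    (fun x hx => by
      rw [abs_mul, abs_of_nonneg (sq_nonneg ‖v x‖)]
      calc |fderiv ℝ φ x (x - x₀)| * ‖v x‖ ^ 2 ≤ C * ‖x - x₀‖ * C ^ 2 :=
            mul_le_mul (hDφξ x) (hv2 x hx) (sq_nonneg _) (by positivity)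
        _ = C * C ^ 2 * ‖x - x₀‖ := by ring)
    (fun x hx => by rw [h0D x hx, zero_apply, zero_mul])
  obtain ⟨T2, B2, I2⟩ := hardyEnergyBound_localHardyIdentity_flux_term x₀ hW₂c hW₂B
  -- (3) the point sink, `g = φ |v|²`
  have hgc : Continuous fun x => φ x * ‖v x‖ ^ 2 := hφcont.mul ((hvc.norm).pow 2)
  have hgs : HasCompactSupport fun x => φ x * ‖v x‖ ^ 2 := hφs.mul_right
  have hgM : ∀ x, |φ x * ‖v x‖ ^ 2| ≤ C * C ^ 2 := by
    intro x
    by_cases hx : x ∈ tsupport φ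
    · rw [abs_mul, abs_of_nonneg (sq_nonneg ‖v x‖)]
      exact mul_le_mul (hφC x) (hv2 x hx) (sq_nonneg _) hC
    · rw [h0φ x hx, zero_mul, abs_zero]
      positivity
  obtain ⟨T3, B3, I3⟩ := hardyEnergyBound_localHardyIdentity_tendsto_sink x₀ hgc hgs hgM
  -- (4) the head term, `G₄ = Dφ(v) (|v|² + 2q)`
  have hG₄c : Continuous fun x => fderiv ℝ φ x (v x) * (‖v x‖ ^ 2 + 2 * q x) :=
    (hDφc.clm_apply hvc).mul hSc
  have hG₄B := hardyEnergyBound_localHardyIdentity_bound_G hR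
    (by positivity : (0 : ℝ) ≤ C * C * (C ^ 2 + 2 * C)) hφR
    (G := fun x => fderiv ℝ φ x (v x) * (‖v x‖ ^ 2 + 2 * q x))
    (fun x hx => by
      rw [abs_mul]
      exact mul_le_mul (hDφv x hx) (hhead x hx) (abs_nonneg _) (by positivity))
    (fun x hx => by rw [h0D x hx, zero_apply, zero_mul])
  obtain ⟨T4, B4, I4⟩ := hardyEnergyBound_localHardyIdentity_weight_term x₀ hG₄c hG₄B
  -- (5) the head flux, `W₅ = φ ⟨x - x₀, v⟩ (|v|² + 2q)`
  have hW₅c : Continuous fun x => φ x * (⟪x - x₀, v x⟫ * (‖v x‖ ^ 2 + 2 * q x)) :=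
    hφcont.mul (((continuous_id.sub continuous_const).inner hvc).mul hSc)
  have hW₅B := hardyEnergyBound_localHardyIdentity_bound_W x₀ hR
    (by positivity : (0 : ℝ) ≤ C * C * (C ^ 2 + 2 * C)) hφR
    (W := fun x => φ x * (⟪x - x₀, v x⟫ * (‖v x‖ ^ 2 + 2 * q x)))
    (fun x hx => by
      rw [abs_mul, abs_mul]
      calc |φ x| * (|⟪x - x₀, v x⟫| * |‖v x‖ ^ 2 + 2 * q x|)
          ≤ C * (‖x - x₀‖ * C * (C ^ 2 + 2 * C)) :=
            mul_le_mul (hφC x) (mul_le_mul (hξv x hx) (hhead x hx) (abs_nonneg _)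
              (by positivity)) (by positivity) hC
        _ = C * C * (C ^ 2 + 2 * C) * ‖x - x₀‖ := by ring)
    (fun x hx => by rw [h0φ x hx, zero_mul])
  obtain ⟨T5, B5, I5⟩ := hardyEnergyBound_localHardyIdentity_flux_term x₀ hW₅c hW₅B
  -- (6) the dissipation, `G₆ = φ |∇v|²_F`
  have hG₆c : Continuous fun x => φ x * frobeniusNormSq (fderiv ℝ v x) :=
    hφcont.mul (LerayHopfProofs.continuous_frobeniusNormSq.comp hDvc)
  have hG₆B := hardyEnergyBound_localHardyIdentity_bound_G hR
    (by positivity : (0 : ℝ) ≤ C * (3 * C ^ 2)) hφR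
    (G := fun x => φ x * frobeniusNormSq (fderiv ℝ v x))
    (fun x hx => by
      rw [abs_mul, abs_of_nonneg (frobeniusNormSq_nonneg _)]
      refine mul_le_mul (hφC x) ?_ (frobeniusNormSq_nonneg _) hC
      calc frobeniusNormSq (fderiv ℝ v x) ≤ 3 * ‖fderiv ℝ v x‖ ^ 2 :=
            BradshawTsai2017.frobeniusNormSq_le_three_mul_norm_sq _
        _ ≤ 3 * C ^ 2 := by
            gcongr
            exact hDvC x hx)
    (fun x hx => by rw [h0φ x hx, zero_mul])
  obtain ⟨T6, B6, I6⟩ := hardyEnergyBound_localHardyIdentity_weight_term x₀ hG₆c hG₆B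
  beta_reduce at T1 B1 I1 T2 B2 I2 T3 B3 I3 T4 B4 I4 T5 B5 I5 T6 B6 I6
  -- the flux, split into the five pieces
  have hFlux : ∀ n : ℕ, (∫ x, (ν * ((Δ (ψ n)) x * ‖v x‖ ^ 2) +
      fderiv ℝ (ψ n) x (v x) * ‖v x‖ ^ 2 + 2 * (q x * fderiv ℝ (ψ n) x (v x)))) =
      ν * (∫ x, (Δ φ) x * ‖v x‖ ^ 2 *
        Newtonian.regKernel ((((n : ℝ) + 1)⁻¹) ^ 2) (x - x₀)) -
      2 * ν * (∫ x, (‖x - x₀‖ ^ 2 + (((n : ℝ) + 1)⁻¹) ^ 2) ^ (-3 / 2 : ℝ) *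
        (fderiv ℝ φ x (x - x₀) * ‖v x‖ ^ 2)) -
      ν * (∫ x, Newtonian.regBump ((((n : ℝ) + 1)⁻¹) ^ 2) (x - x₀) * (φ x * ‖v x‖ ^ 2)) +
      (∫ x, fderiv ℝ φ x (v x) * (‖v x‖ ^ 2 + 2 * q x) *
        Newtonian.regKernel ((((n : ℝ) + 1)⁻¹) ^ 2) (x - x₀)) -
      ∫ x, (‖x - x₀‖ ^ 2 + (((n : ℝ) + 1)⁻¹) ^ 2) ^ (-3 / 2 : ℝ) *
        (φ x * (⟪x - x₀, v x⟫ * (‖v x‖ ^ 2 + 2 * q x))) := by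
    intro n
    rw [hψ n]
    rw [integral_congr_ae (Eventually.of_forall fun x =>
      hardyEnergyBound_localHardyIdentity_integrand_eq x₀ ν (ha n) hφ v q x)]
    exact hardyEnergyBound_localHardyIdentity_integral_five (I1 n) (I2 n) (I3 n) (I4 n) (I5 n)
      _ _ _
  have hDis : ∀ n : ℕ, (∫ x, frobeniusNormSq (fderiv ℝ v x) * ψ n x) =
      ∫ x, φ x * frobeniusNormSq (fderiv ℝ v x) *
        Newtonian.regKernel ((((n : ℝ) + 1)⁻¹) ^ 2) (x - x₀) := by
    intro n
    rw [hψ n]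
    refine integral_congr_ae (Eventually.of_forall fun x => ?_)
    simp only
    ring
  -- the combined limit integral, split into the four pieces
  have hmain : (∫ x, (ν * ‖v x‖ ^ 2 * ((Δ φ) x / ‖x - x₀‖ -
        2 * fderiv ℝ φ x (x - x₀) / ‖x - x₀‖ ^ 3)
        + (‖v x‖ ^ 2 + 2 * q x) * fderiv ℝ φ x (v x) / ‖x - x₀‖
        - 2 * φ x * (‖v x‖ ^ 2 / 2 + q x) * ⟪v x, x - x₀⟫ / ‖x - x₀‖ ^ 3)) =
      ν * (∫ x, (Δ φ) x * ‖v x‖ ^ 2 / ‖x - x₀‖) -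
      2 * ν * (∫ x, fderiv ℝ φ x (x - x₀) * ‖v x‖ ^ 2 / ‖x - x₀‖ ^ 3) +
      (∫ x, fderiv ℝ φ x (v x) * (‖v x‖ ^ 2 + 2 * q x) / ‖x - x₀‖) -
      ∫ x, φ x * (⟪x - x₀, v x⟫ * (‖v x‖ ^ 2 + 2 * q x)) / ‖x - x₀‖ ^ 3 := by
    have i1 := hardyEnergyBound_localHardyIdentity_integrable_G_div x₀ hG₁c hG₁B
    have i2 := hardyEnergyBound_localHardyIdentity_integrable_W_div x₀ hW₂c hW₂B
    have i4 := hardyEnergyBound_localHardyIdentity_integrable_G_div x₀ hG₄c hG₄B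
    have i5 := hardyEnergyBound_localHardyIdentity_integrable_W_div x₀ hW₅c hW₅B
    beta_reduce at i1 i2 i4 i5
    have j1 : Integrable (fun x => ν * ((Δ φ) x * ‖v x‖ ^ 2 / ‖x - x₀‖)) := i1.const_mul ν
    have j2 : Integrable (fun x => 2 * ν * (fderiv ℝ φ x (x - x₀) * ‖v x‖ ^ 2 / ‖x - x₀‖ ^ 3)) :=
      i2.const_mul (2 * ν)
    have j12 : Integrable (fun x => ν * ((Δ φ) x * ‖v x‖ ^ 2 / ‖x - x₀‖) -
        2 * ν * (fderiv ℝ φ x (x - x₀) * ‖v x‖ ^ 2 / ‖x - x₀‖ ^ 3)) := j1.sub j2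
    have j124 : Integrable (fun x => ν * ((Δ φ) x * ‖v x‖ ^ 2 / ‖x - x₀‖) -
        2 * ν * (fderiv ℝ φ x (x - x₀) * ‖v x‖ ^ 2 / ‖x - x₀‖ ^ 3) +
        fderiv ℝ φ x (v x) * (‖v x‖ ^ 2 + 2 * q x) / ‖x - x₀‖) := j12.add i4
    rw [← integral_const_mul, ← integral_const_mul, ← integral_sub j1 j2, ← integral_add j12 i4,
      ← integral_sub j124 i5]
    refine integral_congr_ae (Eventually.of_forall fun x => ?_)
    beta_reduce
    rw [real_inner_comm (x - x₀) (v x)]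
    ring
  refine ⟨?_, fun n => ?_, ?_, fun n => ?_⟩
  · -- the limit of the flux
    have key := (((((T1.const_mul ν).sub (T2.const_mul (2 * ν))).sub (T3.const_mul ν)).add
      T4).sub T5).sub (T6.const_mul (2 * ν))
    have e : (fun n : ℕ => (∫ x, (ν * ((Δ (ψ n)) x * ‖v x‖ ^ 2) +
        fderiv ℝ (ψ n) x (v x) * ‖v x‖ ^ 2 + 2 * (q x * fderiv ℝ (ψ n) x (v x)))) -
        2 * ν * ∫ x, frobeniusNormSq (fderiv ℝ v x) * ψ n x) =
        fun n : ℕ => ν * (∫ x, (Δ φ) x * ‖v x‖ ^ 2 *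
          Newtonian.regKernel ((((n : ℝ) + 1)⁻¹) ^ 2) (x - x₀)) -
        2 * ν * (∫ x, (‖x - x₀‖ ^ 2 + (((n : ℝ) + 1)⁻¹) ^ 2) ^ (-3 / 2 : ℝ) *
          (fderiv ℝ φ x (x - x₀) * ‖v x‖ ^ 2)) -
        ν * (∫ x, Newtonian.regBump ((((n : ℝ) + 1)⁻¹) ^ 2) (x - x₀) * (φ x * ‖v x‖ ^ 2)) +
        (∫ x, fderiv ℝ φ x (v x) * (‖v x‖ ^ 2 + 2 * q x) *
          Newtonian.regKernel ((((n : ℝ) + 1)⁻¹) ^ 2) (x - x₀)) -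
        (∫ x, (‖x - x₀‖ ^ 2 + (((n : ℝ) + 1)⁻¹) ^ 2) ^ (-3 / 2 : ℝ) *
          (φ x * (⟪x - x₀, v x⟫ * (‖v x‖ ^ 2 + 2 * q x)))) -
        2 * ν * ∫ x, φ x * frobeniusNormSq (fderiv ℝ v x) *
          Newtonian.regKernel ((((n : ℝ) + 1)⁻¹) ^ 2) (x - x₀) := by
      funext n
      rw [hFlux n, hDis n]
    rw [e, hmain]
    convert key using 2
    ring
  · -- the uniform bound on the flux
    rw [hFlux n, hDis n]
    exact hardyEnergyBound_localHardyIdentity_six_bound (B1 n) (B2 n) (B3 n) (B4 n) (B5 n) (B6 n)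
  · -- the limit of the dissipation
    refine T6.congr fun n => ?_
    rw [hDis n]
  · -- the uniform bound on the dissipation
    rw [hDis n]
    exact B6 n

end Summit.NavierStokesRegularity.NavierStokesRegularity.Theorems

end
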